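import Literature.MathematicalPhysics.QuantumFieldTheory.Balaban1983to89.B9Eq3132TentKinetic
import Literature.MathematicalPhysics.QuantumFieldTheory.Balaban1983to89.B9Eq3132ApproxRightInverse

/-!
# `Balaban1983to89.B9Eq3132TentBumps` — T. Bałaban, *Propagators and renormalization transformations for lattice gauge theories. II*, Commun. Math. Phys. **96** (1984)
# 223–250 [Balaban1984PropagatorsII], (2.147) p. 248 with (2.81) p. 237: THE TREE'S TENT BUMPS AS PROFILES OF TRANSPORTED TENTS — support, FORWARD CLOSURE
# (`θ_y⟨z,μ⟩ ≠ 0 ⇒ z + e_μ ∈ Bʲ(base y)`), and the two HOMOGENEITY bounds `c_f²Λ_y²·gradSq θ_y ≤ C_∇(d)`, `c_f²Λ_y²(Lʲ)⁻²·massSq θ_y ≤ C_Θ(d) = 2500·64^d`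
# (part 3 of step F-d of the (P′1) roadmap for row 26's `hP1`)

statement-level skeleton of published theorems with citation tags; proofs where landed; nothing here is a claim about the Yang–Mills mass gap

THE PRINT.  [4] p. 248 (2.147) (the tent test functions of the lower bound on `QGQ*`; tree: `B6QGQTestBumpsKLevelV1.bump`, `B6QGQCoerciveKLevelV1.gpart_hom`); (2.81) p. 237 (`Λ_j`).

WHY THIS FILE (dag-n06-i gen 14, N06 bundle F4, row 26).  `B9Eq3132TentKinetic` bounds the kinetic quantities of one transported tent by `gradSq θ` and `ϑ²·massSq θ` of its
profile; for the profile `θ_y = φ_y∕m_y` of the certificate's test family (`B9Eq3132ApproxRightInverse.bumpProfile`) these are `k`-UNIFORMLY bounded after the weights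
`c_f²Λ_y²` resp. `c_f²Λ_y²(Lʲ)⁻²`: the gradient part is the tree's `nu_sq_grad_le`; the mass part (`Σ_fφ_y² ≤ r²Lʲ(Στ_⊥²)^d` against `A·m_y ≥ (1∕250)L^{2j}(L^{2j}∕8)^d`) is new.
The forward closure (the longitudinal tent vanishes on the last slice, `tauL_last`) is what lets the curvature weight of a plaquette be read inside the base block.

WHAT IS PROVED (sorry-free; defs `baseBlk`, `orgY`, `sideY`, `Cth`).
* `bumpProfile_src_mem`, ★ `bumpProfile_fwd`, `pdiff_bumpProfile`, `gradSq_bumpProfile`, `massSq_bumpProfile`, `cf_sq_mul_lamY_sq`, ★ `gradSq_hom`, `sum_bump_sq_le`, ★ `massSq_hom`.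
* §2 (v1.1, appended): `one_le_sideY`, `inv_sideY_le_one`.

HONEST SCOPE.  Bookkeeping over the tree's [4]-machinery; nothing of [B9] asserted; count-neutral; N06 NOT discharged.  Cell `pub-ymgap` (HUMAN RULING D-0062), Track A node N06 [B9],
seat `pub-ymgap-dag-n06-i` (gen 14), 2026-08-27; a NEW file.
-/

noncomputable section

namespace Literature.MathematicalPhysics.QuantumFieldTheory.Balaban1983to89.B9Eq3132TentBumps

open Node00
open B6KLevelCensusIndexV1 (KIdx)
open B6GlobalChartV1 (PV domT)
open B6Ineq2142KLevelV1 (lvl base qwt qwt_nonneg)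
open B5Eq118OneStroke (iterBlock mem_iterBlock)
open B15DeterminingSets (embIter)
open B9Eq39Adjoint (R R_add R_sub R_mul R_one R_smul R_zero)
open B9Thm311ReadingCoords (trIP trIP_eq_re_trace)
open B9Ineq369CurvatureSmallAtLettersY (hs_nonneg hs_R_le trIP_one_self_eq norm_weight_eq)
open B9Thm311PosOfPrincipalAtLettersY (norm_reHolY_sub_one_le norm_imHolY_le)
open B9Eq3132NuReading (lamY lamY_pos)
open B9Eq3132TentOperator (tentOp QY_tentOp_apply eWt)
open B9Eq3132TentCurl (tentField curlY_tentField divY_tentField tentOp_summand_eq_tentField)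
open B9Eq3132ApproxRightInverse (bumpProfile bumpProfile_nonneg two_le_sitesPerDir mass_pos' wt_eq_lamY_sq eWt_bumpProfile)
open B9Thm311FlippedBondLetters (hs_real_smul)
open B9Eq3132TentFlat (pdiff gradSq massSq gradSq_nonneg massSq_nonneg hs_sum_le_card_support_mul hs_sum_le_card_mul)
open B9Eq3132TentKinetic (contractive_of_mem lasso_mem_unitary sum_hs_curlY_tentField_le sum_hs_divY_tentField_le sum_weight_edge_le hs_tentField_le)
open B6QGQTestBumpsKLevelV1 (bump bump_ne_zero_imp rad loc card_bump_support_le card_pair_support_le)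
open B6QGQCoerciveKLevelV1 (mass nu Cgrad tauL_last tauL_le_rad shift_mem_iff Adens Adens_nonneg bump_eq_of_mem sum_Adens_long TT2 TT2_le tsumL_ge Tsum_ge mass_mul
  nu_sq_grad_le nu_sq_q_le hwup_of_globalBand)
open B6Prop27KLevelV1 (wt wt_pos)
open B9GeoLemma21KLevelV1 (one_le_k)
open B9Eq3132Ineq2142Covariant (two_le_RMh)
open scoped Matrix Matrix.Norms.L2Operator

variable {N : ℕ} {d ℓ : ℕ} {hd : 1 ≤ d + 1} {hL : Odd (ℓ + 1) ∧ 1 < ℓ + 1} {b₀ b₁ : ℝ} (i : KIdx d ℓ hd hL b₀ b₁)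

/-! ## §1 The tree's bumps as profiles: support, forward closure, homogeneity -/

section Bumps

/-- the base block `Bʲ(base y)` of an index bond (fine sites). [cite: Balaban1984PropagatorsII, (2.3) p.224, (2.147) p.248] -/
def baseBlk (y : IBondY i) : Finset (Site (PV d ℓ i.m i.K hd hL) 0) := iterBlock (lvl i.hN i.D i.hk y) (base i.hN i.D i.hk y)

/-- def-Y's transport origin of the index bond `y`: the representative fine site of its source block (`qT parB U y b = parB U (orgY y) b₋`).
[cite: Balaban1985BackgroundPropagators, (3.13) p.393, (3.40) p.397] -/
def orgY (y : IBondY i) : Site (PV d ℓ i.m i.K hd hL) 0 := embIter (y.1.1 : ℕ) y.1.2.src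

/-- the side `Lʲ` of the base block, as a real. [cite: Balaban1984PropagatorsII, (2.1) p.224, bookkeeping] -/
def sideY (y : IBondY i) : ℝ := (((ℓ + 1 : ℕ) : ℝ)) ^ (lvl i.hN i.D i.hk y)

/-- `Lʲ > 0`. [cite: Balaban1984PropagatorsII, (2.1) p.224, bookkeeping] -/
theorem sideY_pos (y : IBondY i) : 0 < sideY i y := by unfold sideY; positivity

/-- `θ_y ≥ 0`. [cite: Balaban1984PropagatorsII, (2.147) p.248, bookkeeping] -/
theorem bumpProfile_nonneg' (y : IBondY i) (f : FBondY i) : 0 ≤ bumpProfile i y f := bumpProfile_nonneg i y f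

/-- the support of `θ_y`: direction `μ_y`, source in the base block. [cite: Balaban1984PropagatorsII, (2.147) p.248, bookkeeping] -/
theorem bumpProfile_src_mem (y : IBondY i) {f : FBondY i} (h : bumpProfile i y f ≠ 0) : f.dir = y.1.2.dir ∧ f.src ∈ baseBlk i y := by
  have hb : bump i.hN i.D i.hk y f ≠ 0 := fun e => h (by rw [bumpProfile, e, zero_div])
  exact bump_ne_zero_imp i.hN i.D i.hk y hb

/-- ★ **FORWARD CLOSURE OF THE BUMPS**: `θ_y⟨z, μ⟩ ≠ 0 ⇒ z + e_μ ∈ Bʲ(base y)` — the longitudinal tent vanishes on the last slice (`tauL_last`), so a non-zero bond is never on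
the far face of its block. [cite: Balaban1984PropagatorsII, (2.147) p.248, bookkeeping] -/
theorem bumpProfile_fwd (y : IBondY i) {f : FBondY i} (h : bumpProfile i y f ≠ 0) : f.src.shift f.dir ∈ baseBlk i y := by
  have hb : bump i.hN i.D i.hk y f ≠ 0 := fun e => h (by rw [bumpProfile, e, zero_div])
  obtain ⟨hdir, hsrc⟩ := bump_ne_zero_imp i.hN i.D i.hk y hb
  have hmem := (shift_mem_iff (B6Ineq2142KLevelV1.lvl_le_mK i.hN i.D i.hk y) (two_le_sitesPerDir i _) hsrc f.dir).1
  refine hmem.2 ?_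
  have hlt := B6QGQTestBumpsKLevelV1.loc_lt (lvl i.hN i.D i.hk y) f.src f.dir
  by_contra hge
  have hlast : loc (lvl i.hN i.D i.hk y) f.src f.dir = (ℓ + 1) ^ (lvl i.hN i.D i.hk y) - 1 := by omega
  apply hb
  obtain ⟨s, μ⟩ := f
  simp only at hdir hsrc hlast
  subst hdir
  rw [bump_eq_of_mem i.hN i.D i.hk y hsrc, hlast, tauL_last, zero_mul]

/-- the profile differences are the tree's bump differences over the mass. [cite: Balaban1984PropagatorsII, (2.147) p.248, bookkeeping] -/
theorem pdiff_bumpProfile (y : IBondY i) (ν : Fin (PV d ℓ i.m i.K hd hL).d) (f : FBondY i) :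
    pdiff i (bumpProfile i y) ν f = B6QGQTestBumpsKLevelV1.bdiff (bump i.hN i.D i.hk y) ν f / mass i.hN i.D i.hk y := by
  unfold pdiff bumpProfile B6QGQTestBumpsKLevelV1.bdiff
  ring

/-- `gradSq θ_y = G(φ_y)∕m_y²`. [cite: Balaban1984PropagatorsII, (2.147) p.248, bookkeeping] -/
theorem gradSq_bumpProfile (y : IBondY i) :
    gradSq i (bumpProfile i y) = (∑ f : FBondY i, ∑ ν : Fin (PV d ℓ i.m i.K hd hL).d, B6QGQTestBumpsKLevelV1.bdiff (bump i.hN i.D i.hk y) ν f ^ 2) / mass i.hN i.D i.hk y ^ 2 := by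
  unfold gradSq
  rw [Finset.sum_div]
  refine Finset.sum_congr rfl fun f _ => ?_
  rw [Finset.sum_div]
  refine Finset.sum_congr rfl fun ν _ => ?_
  rw [pdiff_bumpProfile, div_pow]

/-- `massSq θ_y = Σφ_y²∕m_y²`. [cite: Balaban1984PropagatorsII, (2.147) p.248, bookkeeping] -/
theorem massSq_bumpProfile (y : IBondY i) : massSq i (bumpProfile i y) = (∑ f : FBondY i, bump i.hN i.D i.hk y f ^ 2) / mass i.hN i.D i.hk y ^ 2 := by
  unfold massSq bumpProfile
  rw [Finset.sum_div]
  exact Finset.sum_congr rfl fun f _ => by rw [div_pow]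

/-- `c_f²Λ_y² = (Lʲ)²∕(L^D)ʲ`. [cite: Balaban1984PropagatorsII, (2.81) p.237, bookkeeping] -/
theorem cf_sq_mul_lamY_sq (y : IBondY i) : i.cf ^ 2 * lamY i y ^ 2 = sideY i y ^ 2 * (((((ℓ + 1 : ℕ) : ℝ)) ^ (d + 1)) ^ (lvl i.hN i.D i.hk y))⁻¹ := by
  rw [← wt_eq_lamY_sq, wt, sideY, div_pow]
  have hcf : i.cf ≠ 0 := i.hcf
  field_simp

/-- ★ **HOMOGENEITY OF THE GRADIENT PART**: `c_f²Λ_y²·gradSq θ_y ≤ C_∇(d)` (the tree's `nu_sq_grad_le`). [cite: Balaban1984PropagatorsII, (2.147) p.248] -/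
theorem gradSq_hom (y : IBondY i) : i.cf ^ 2 * lamY i y ^ 2 * gradSq i (bumpProfile i y) ≤ Cgrad d := by
  have hper : ∀ n, n ≤ i.k + 1 → 2 ≤ (PV d ℓ i.m i.K hd hL).sitesPerDir n := fun n _ => two_le_sitesPerDir i n
  have h := nu_sq_grad_le i.hN i.D i.hk (one_le_k i) i.hℓ hper i.hcf y
  have hm := mass_pos' i y
  have hW := wt_pos i.hN i.D i.hk i.hcf y
  rw [gradSq_bumpProfile, ← wt_eq_lamY_sq]
  unfold nu mass at h
  unfold mass
  rw [div_pow] at h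
  -- `h : wt²/m² · (c_f² G) ≤ Cgrad · wt`
  have h' : wt i.hN i.D i.hk i.cf y * (i.cf ^ 2 * (∑ f : FBondY i, ∑ ν : Fin (PV d ℓ i.m i.K hd hL).d,
      B6QGQTestBumpsKLevelV1.bdiff (bump i.hN i.D i.hk y) ν f ^ 2) / B6SectAOperatorsV1.QE (domT i.hN i.D i.hk) (bump i.hN i.D i.hk y) y ^ 2) ≤ Cgrad d := by
    have e : wt i.hN i.D i.hk i.cf y ^ 2 / B6SectAOperatorsV1.QE (domT i.hN i.D i.hk) (bump i.hN i.D i.hk y) y ^ 2 *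
        (i.cf ^ 2 * ∑ f : FBondY i, ∑ ν : Fin (PV d ℓ i.m i.K hd hL).d, B6QGQTestBumpsKLevelV1.bdiff (bump i.hN i.D i.hk y) ν f ^ 2) =
        wt i.hN i.D i.hk i.cf y * (wt i.hN i.D i.hk i.cf y * (i.cf ^ 2 * (∑ f : FBondY i, ∑ ν : Fin (PV d ℓ i.m i.K hd hL).d,
          B6QGQTestBumpsKLevelV1.bdiff (bump i.hN i.D i.hk y) ν f ^ 2) / B6SectAOperatorsV1.QE (domT i.hN i.D i.hk) (bump i.hN i.D i.hk y) y ^ 2)) := by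
      field_simp
    rw [e] at h
    exact le_of_mul_le_mul_left (h.trans (le_of_eq (mul_comm _ _))) hW
  calc i.cf ^ 2 * wt i.hN i.D i.hk i.cf y * ((∑ f : FBondY i, ∑ ν : Fin (PV d ℓ i.m i.K hd hL).d,
        B6QGQTestBumpsKLevelV1.bdiff (bump i.hN i.D i.hk y) ν f ^ 2) / B6SectAOperatorsV1.QE (domT i.hN i.D i.hk) (bump i.hN i.D i.hk y) y ^ 2)
      = wt i.hN i.D i.hk i.cf y * (i.cf ^ 2 * (∑ f : FBondY i, ∑ ν : Fin (PV d ℓ i.m i.K hd hL).d,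
        B6QGQTestBumpsKLevelV1.bdiff (bump i.hN i.D i.hk y) ν f ^ 2) / B6SectAOperatorsV1.QE (domT i.hN i.D i.hk) (bump i.hN i.D i.hk y) y ^ 2) := by ring
    _ ≤ Cgrad d := h'

/-- `Σ_f φ_y(f)² ≤ r²·Lʲ·(Στ_⊥²)^d` (`τ ≤ r` and the transverse product density sums by `sum_Adens_long`). [cite: Balaban1984PropagatorsII, (2.147) p.248, bookkeeping] -/
theorem sum_bump_sq_le (y : IBondY i) :
    ∑ f : FBondY i, bump i.hN i.D i.hk y f ^ 2 ≤
      (rad i.hN i.D i.hk y : ℝ) ^ 2 * ((((ℓ + 1) ^ (lvl i.hN i.D i.hk y) : ℕ) : ℝ) * TT2 (ℓ := ℓ) (lvl i.hN i.D i.hk y) ^ d) := by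
  classical
  set j := lvl i.hN i.D i.hk y
  set μ := y.1.2.dir
  set B := baseBlk i y with hBdef
  -- per site: only the `μ`-bond carries the bump, and `φ² ≤ r²·A_μ`
  have h1 : ∀ x : Site (PV d ℓ i.m i.K hd hL) 0, ∑ ν : Fin (PV d ℓ i.m i.K hd hL).d, bump i.hN i.D i.hk y ⟨x, ν⟩ ^ 2 ≤
      (rad i.hN i.D i.hk y : ℝ) ^ 2 * Adens i.hN i.D i.hk y μ x := by
    intro x
    rw [Finset.sum_eq_single μ (fun ν _ hν => by
      have : bump i.hN i.D i.hk y ⟨x, ν⟩ = 0 := by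
        by_contra h; exact hν (bump_ne_zero_imp i.hN i.D i.hk y h).1
      rw [this]; ring) (fun h => (h (Finset.mem_univ _)).elim)]
    by_cases hx : x ∈ B
    · rw [hBdef, baseBlk] at hx
      rw [bump_eq_of_mem i.hN i.D i.hk y hx, mul_pow, ← Finset.prod_pow]
      unfold Adens B6QGQCoerciveKLevelV1.Theta
      rw [if_pos hx, if_pos rfl]
      refine mul_le_mul_of_nonneg_right (pow_le_pow_left₀ (B6QGQTestBumpsKLevelV1.tauL_nonneg i.hN i.D i.hk y _) (tauL_le_rad i.hN i.D i.hk y _) 2)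
        (Finset.prod_nonneg fun _ _ => sq_nonneg _)
    · rw [hBdef, baseBlk] at hx
      rw [B6QGQCoerciveKLevelV1.bump_eq_zero_of_not_mem i.hN i.D i.hk y hx]
      simpa using mul_nonneg (sq_nonneg (rad i.hN i.D i.hk y : ℝ)) (Adens_nonneg i.hN i.D i.hk y μ x)
  rw [B10StarCount.sum_pbond]
  refine (Finset.sum_le_sum fun x _ => h1 x).trans ?_
  rw [← Finset.mul_sum]
  refine mul_le_mul_of_nonneg_left (le_of_eq ?_) (sq_nonneg _)
  rw [← sum_Adens_long i.hN i.D i.hk y, ← Finset.sum_subset (Finset.subset_univ _)]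
  intro x _ hx
  unfold Adens; rw [if_neg hx]

/-- the mass-homogeneity constant `C_Θ(d) = 2500·64^d`. [cite: Balaban1984PropagatorsII, (2.147) p.248, bookkeeping ours] -/
def Cth (d : ℕ) : ℝ := 2500 * 64 ^ d

/-- ★ **HOMOGENEITY OF THE MASS**: `c_f²Λ_y²·(Lʲ)⁻²·massSq θ_y ≤ C_Θ(d)` — the tent bump carries `Σθ² = O(L^{jD})`, and `c_f²Λ_y²(Lʲ)⁻² = (L^D)^{−j}`.
[cite: Balaban1984PropagatorsII, (2.147) p.248, (2.81) p.237] -/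
theorem massSq_hom (y : IBondY i) : i.cf ^ 2 * lamY i y ^ 2 * (sideY i y)⁻¹ ^ 2 * massSq i (bumpProfile i y) ≤ Cth d := by
  set j := lvl i.hN i.D i.hk y
  set Lr : ℝ := ((ℓ + 1 : ℕ) : ℝ)
  set A : ℝ := (Lr ^ (d + 1)) ^ j with hA
  set Sr : ℝ := Lr ^ j with hSr
  set mm : ℝ := mass i.hN i.D i.hk y
  set r : ℝ := (rad i.hN i.D i.hk y : ℝ)
  set Mt : ℝ := B6QGQTestBumpsKLevelV1.tsumL i.hN i.D i.hk y * B6QGQTestBumpsKLevelV1.Tsum (ℓ := ℓ) j ^ d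
  have hper := two_le_sitesPerDir i j
  have hS0 : 0 < Sr := by positivity
  have hA0 : 0 < A := by positivity
  have hAS : A = Sr ^ (d + 1) := pow_right_comm _ _ _
  have hm : 0 < mm := mass_pos' i y
  have hcast : ((((ℓ + 1) ^ j : ℕ)) : ℝ) = Sr := Nat.cast_pow _ _
  have h5 : 5 * r ≤ Sr := by
    have h' : ((5 * rad i.hN i.D i.hk y : ℕ) : ℝ) ≤ (((ℓ + 1) ^ j : ℕ) : ℝ) := by exact_mod_cast B6QGQTestBumpsKLevelV1.five_mul_rad_le i.hN i.D i.hk y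
    rw [Nat.cast_pow, Nat.cast_mul, show ((5 : ℕ) : ℝ) = 5 by norm_num] at h'
    exact h'
  have h10 : Sr ≤ 10 * r := by
    have h' : (((ℓ + 1) ^ j : ℕ) : ℝ) ≤ ((10 * rad i.hN i.D i.hk y : ℕ) : ℝ) := by
      exact_mod_cast B6QGQCoerciveKLevelV1.pow_le_ten_mul_rad i.hN i.D i.hk (one_le_k i) i.hℓ y
    rw [Nat.cast_pow, Nat.cast_mul, show ((10 : ℕ) : ℝ) = 10 by norm_num] at h'
    exact h'
  have hr0 : 0 ≤ r := Nat.cast_nonneg _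
  -- the bump mass from above: `Σφ² ≤ Sr³(Sr³)^d/25`
  have hT2 : TT2 (ℓ := ℓ) j ≤ Sr ^ 3 := by have := TT2_le (ℓ := ℓ) j; rwa [hcast] at this
  have hT20 : 0 ≤ TT2 (ℓ := ℓ) j := Finset.sum_nonneg fun t _ => sq_nonneg _
  have hb2 : ∑ f : FBondY i, bump i.hN i.D i.hk y f ^ 2 ≤ Sr ^ 3 * (Sr ^ 3) ^ d / 25 := by
    have h := sum_bump_sq_le i y
    rw [hcast] at h
    have hr2 : r ^ 2 ≤ Sr ^ 2 / 25 := by nlinarith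
    calc _ ≤ r ^ 2 * (Sr * TT2 (ℓ := ℓ) j ^ d) := h
      _ ≤ (Sr ^ 2 / 25) * (Sr * (Sr ^ 3) ^ d) := mul_le_mul hr2 (mul_le_mul_of_nonneg_left (pow_le_pow_left₀ hT20 hT2 d) hS0.le) (by positivity) (by positivity)
      _ = _ := by ring
  -- the mass from below: `(1/250)Sr²(Sr²/8)^d ≤ A·m`
  have hmass : mm * (A * Sr) = (Sr - r) * Mt := mass_mul i.hN i.D i.hk (one_le_k i) i.hℓ y hper
  have htsum : Sr ^ 2 / 200 ≤ B6QGQTestBumpsKLevelV1.tsumL i.hN i.D i.hk y := by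
    have := tsumL_ge i.hN i.D i.hk (one_le_k i) i.hℓ y
    nlinarith
  have hTsum : Sr ^ 2 / 8 ≤ B6QGQTestBumpsKLevelV1.Tsum (ℓ := ℓ) j := by have := Tsum_ge (ℓ := ℓ) j; rwa [Nat.cast_pow] at this
  have hM : Sr ^ 2 / 200 * (Sr ^ 2 / 8) ^ d ≤ Mt :=
    mul_le_mul htsum (pow_le_pow_left₀ (by positivity) hTsum d) (by positivity) (le_trans (by positivity) htsum)
  have hM0 : 0 ≤ Mt := le_trans (by positivity) hM
  have hAm : (1 / 250) * Sr ^ 2 * (Sr ^ 2 / 8) ^ d ≤ A * mm := by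
    have h1 : (4 / 5 * Sr) * Mt ≤ A * mm * Sr := by
      have : A * mm * Sr = (Sr - r) * Mt := by rw [← hmass]; ring
      rw [this]; exact mul_le_mul_of_nonneg_right (by linarith) hM0
    have h2 : (4 / 5 * Sr) * (Sr ^ 2 / 200 * (Sr ^ 2 / 8) ^ d) ≤ (4 / 5 * Sr) * Mt := mul_le_mul_of_nonneg_left hM (by positivity)
    have h3 : (4 / 5 * Sr) * (Sr ^ 2 / 200 * (Sr ^ 2 / 8) ^ d) = ((1 / 250) * Sr ^ 2 * (Sr ^ 2 / 8) ^ d) * Sr := by ring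
    rw [h3] at h2
    exact le_of_mul_le_mul_right (h2.trans h1) hS0
  set Q : ℝ := (1 / 250) * Sr ^ 2 * (Sr ^ 2 / 8) ^ d with hQ
  have hQ0 : 0 < Q := by positivity
  -- assemble
  rw [cf_sq_mul_lamY_sq, massSq_bumpProfile]
  show Sr ^ 2 * A⁻¹ * Sr⁻¹ ^ 2 * ((∑ f : FBondY i, bump i.hN i.D i.hk y f ^ 2) / mm ^ 2) ≤ Cth d
  have e1 : Sr ^ 2 * A⁻¹ * Sr⁻¹ ^ 2 * ((∑ f : FBondY i, bump i.hN i.D i.hk y f ^ 2) / mm ^ 2) =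
      (∑ f : FBondY i, bump i.hN i.D i.hk y f ^ 2) * A / (A * mm) ^ 2 := by
    field_simp
  rw [e1]
  have hAm0 : 0 < A * mm := mul_pos hA0 hm
  calc (∑ f : FBondY i, bump i.hN i.D i.hk y f ^ 2) * A / (A * mm) ^ 2 ≤ (Sr ^ 3 * (Sr ^ 3) ^ d / 25) * A / (A * mm) ^ 2 := by
        gcongr
    _ ≤ (Sr ^ 3 * (Sr ^ 3) ^ d / 25) * A / Q ^ 2 :=
        div_le_div_of_nonneg_left (by positivity) (by positivity) (pow_le_pow_left₀ hQ0.le hAm 2)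
    _ = Cth d := by
        have e64 : (64 : ℝ) ^ d = 8 ^ (d * 2) := by rw [mul_comm, pow_mul]; norm_num
        rw [hQ, hAS, Cth, e64, div_pow]
        have hS' : Sr ≠ 0 := hS0.ne'
        field_simp
        ring

end Bumps

/-! ## §2 Two normalisations of the side (v1.1, appended): `Lʲ ≥ 1`, so a defect `ω·(Lʲ)⁻¹` is at most `ω` -/

section Side

/-- `Lʲ ≥ 1`. [cite: Balaban1984PropagatorsII, (2.1) p.224, bookkeeping] -/
theorem one_le_sideY (y : IBondY i) : 1 ≤ sideY i y := by
  unfold sideY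
  exact one_le_pow₀ (by exact_mod_cast Nat.succ_le_succ (Nat.zero_le ℓ))

/-- `(Lʲ)⁻¹ ≤ 1`: a lasso ∕ plaquette defect `ω·(Lʲ)⁻¹` resp. `ϖ·(Lʲ)⁻²` read at scale `j` is at most `ω` resp. `ϖ`. [cite: Balaban1984PropagatorsII, (2.1) p.224, bookkeeping] -/
theorem inv_sideY_le_one (y : IBondY i) : (sideY i y)⁻¹ ≤ 1 := inv_le_one_of_one_le₀ (one_le_sideY i y)

end Side

end Literature.MathematicalPhysics.QuantumFieldTheory.Balaban1983to89.B9Eq3132TentBumps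

end
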